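import Summits.QuantumFields.BalabanUV.Beta.FP.TowerDoorDefectFamilyLoc
import Summits.QuantumFields.BalabanUV.Beta.FP.TowerDoorDefectLinear
import Summits.QuantumFields.BalabanUV.Beta.FP.TowerK2bDoorReadoutPeriodised

/-!
# `BalabanUV.Beta.FP.TowerDoorPeriodisedSource` — binder row D1, the row's ONE file, (T2) `hWΔT` part (D-b1) (J-NOTE-21 §5; v10 `FP/StepRecursionFeedNestedNamedI` l.217):
# **THE SOURCE WINDING OF THE DOOR, POINTWISE** — for a block-covariant, exponentially localised gauge-function family `lam` and a covariant, exponentially decaying read-out weight `S`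
# (generic letters `L tabs κ₂ κΔ lam S`, coarse box `Mc`, torus `T = L•Mc`):
# `Σ'_e doorZ … μ y ν (y′ + Mc∘e) x w a b = κΔ · Σ_κ Σ'_{y₀} ((Σ'_e S ν (y′ + Mc∘e) κ y₀) · defKerZ … (lam μ y) (y₀,κ) x w a b + S μ y κ y₀ · defKerZ … (Σ'_e lam ν (y′ + Mc∘e)) (y₀,κ) x w a b)`
# — the winding lands on the WEIGHT for the `μ`-source term and INSIDE THE GAUGE SLOT for the `ν`-source term (road (R3) `defKerZ_tsum`)
# (β-function cell `pub-balaban`, BINDER-OWNERS row D1 ∕ (C1) OWNER «beta-an2» gen 78, PART 71; imports road (R1) `TowerDoorDefectFamilyLoc` + (R3) `TowerDoorDefectLinear` + PART 47)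

WHY (located; J-NOTE-21 §5, journal [AN2-G78-ONLINE] A-1 (i)).  (T2)'s left side winds the door's SECOND source over the coarse period lattice: `Σ'_e 𝒲Δ (n+1) μ y ν (translate (Mc B) y′ e)`.
By PART 62 `doorZ_apply` each copy is `κΔ·Σ_κ Σ'_{y₀} (S ν (y′+Mc∘e) κ y₀ · Def(lam μ y)(y₀,κ) + S μ y κ y₀ · Def(lam ν (y′+Mc∘e))(y₀,κ))`; the `e`-sum is exchanged with the window sum
`y₀` (dominated: lit-shape weight decay `CS·e^{−δS|y₀ − z|₁}` × road (R1) `biLoc_defKerZ_of_loc`'s constant `A·e^{−(ρ/2)|L•q − L•y₀|₁}`, every `e`-sum a translate sum of road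
`summable_exp_l1_translate`), after which the first term carries the PERIODISED WEIGHT `Σ'_e S ν (translate Mc y′ e) κ y₀` (PART 47's `perF T (AN …) (… inr κ) (… inr ν)` at the record)
and the second the defect kernel of the PERIODISED GAUGE FUNCTION `Λ_(ν,y′) := Σ'_e lam ν (translate Mc y′ e)` (PART 57's `lv` at the record) by road (R3) `defKerZ_tsum`.  After this file
the door kernel no longer mentions the winding, and is a window superposition of kernels bi-localised at `(L•y₀, L•y₀)` with constants summable in `y₀` — the input of PART 70's
`perZ_dper_tsum_of_biLoc` (part (D-b2)).

WHAT ([folklore] `tsum` bookkeeping BY NAME; the tables' (Lmix)(LH) are READ OFF `tabs : SymTables 3 L` (`tabs.hmix`, `tabs.hH` at the aligned rate) — no table hypothesis; no `def`,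
no `def … : Prop`, nothing cited, 0 sorry).  Hypotheses (v10's record shapes, PART 59 ∕ lit `decay_wΦ` ∕ PART 58 ∕ PART 46): `hlam : |lam μ y u| ≤ K·e^{−δv|L•y − u|₁}`,
`hS : |S ν z κ y₀| ≤ CS·e^{−δS|y₀ − z|₁}`, and the torus letter `hT : T i = L · Mc i`.
* §1 `exists_aligned_rates`, `exists_biLoc_defKerZ_lam` (ONE rate `ρ ≤ δv` with (Lmix)(LH) read off `tabs`; road (R1) at every source), `exists_biLoc_defKerZ_bdd` (PART 64 for a BOUNDED
  gauge function), `exp_block_le` (`e^{−ρ|L•y − L•y₀|₁} ≤ e^{−ρ|y − y₀|₁}`).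
* §2 `abs_lam_translate_le`, `summable_abs_lam_sources` (`Σ'_e |lam μ (translate Mc y e) u| ≤ K·K₄(δv)`), `abs_tsum_lam_sources_le` — the periodised gauge function is bounded.
* §3 `tsum_sources_weight_mul_defKerZ` (the `μ`-source term: winding onto the weight), `tsum_sources_weight_mul_defKerZ_gauge` (the `ν`-source term: winding into the gauge slot, (R3)),
  each with the summabilities it produces; §4 **`tsum_sources_doorZ_apply`** ∕ **`tsum_sources_doorZ_eq`** (the display above, pointwise and as a kernel equation).
WHAT THIS IS NOT: not (T2) (parts (D-b2) `perF∘dper` through the window sum + the window regrouping, (D-c) the record); nothing of Bałaban's asserted, valued or discharged; 0 estimates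
beyond bookkeeping constants (existential); 0∕4 row-D1 binders (hW, hR, D1Tel, D1Rep); v10 NOT filed; v9 p617999 stands; NOT (C1), NOT (T-ID), NOT D1, NEVER «G-an2-4 closed»,
NOT BetaPertH, NOT continuum, NOT Clay.

HONEST DEPENDENCY (page 1, mandatory): continuum YM on T⁴ ⇐ BetaPertH ∧ nine spine estimates (0/9 proved); BetaPertH ⇐ (D1) ∧ (D4) ∧ CAP+tail;
G-an2-4 gates asym, D1 and NE2/3/4.  HONEST FRAMING (cell contract, verbatim): «discharging `BetaPertH` makes Bałaban's UV stability UNCONDITIONAL —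
a real constructive-QFT result; it is NOT the continuum limit and NOT the Clay problem.»  ABSOLUTE RULE (cell charter, verbatim): «No internally-minted
statement may enter as a cited fact. Every hypothesis is either kernel-proved in this package or a verbatim quotation of a PUBLISHED theorem with page
reference. The manuscript(s) under audit are NOT citable for their own disputed steps — they are the thing under adjudication; programme-internal
(2001/route/tribunal) claims are never citable.»  Row D1 ∕ (C1) OWNER «beta-an2» gen 78, 2026-08-29.  No existing file touched.
-/

noncomputable section

open Finset
open scoped BigOperators
open Literature.MathematicalPhysics.QuantumFieldTheory
open Literature.MathematicalPhysics.QuantumFieldTheory.Balaban1983to89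
open Literature.MathematicalPhysics.QuantumFieldTheory.Balaban1983to89.Beta
open Literature.MathematicalPhysics.QuantumFieldTheory.Balaban1983to89.B12Sec2to5 (l1 l1_nonneg)
open B4TorusKernel.MultiPeriod (translate translate_apply)
open B4Reflection242 (translate_translate)
open B4Sect5Proof (latticeConst latticeConst_nonneg)
open AffineAveraging (Site unitVec)
open OneStepResolventKernel (Fib)
open ExpKernelCalculus (MKer BiLoc VertexFamily Zl Zl_nonneg l1_sub_symm summable_exp_shift summable_exp_shift')
open SecondOrderResponse (LocStencilFM)
open BalabanStepW2 (wM2)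
open Summit.QuantumFields.BalabanUV.Beta.SymmetrisedStepJets (SymTables)
open Summit.QuantumFields.BalabanUV.Beta.FP.KernelPeriodisationFibLoc (summable_exp_l1_translate)
open Summit.QuantumFields.BalabanUV.Beta.FP.TowerK2bDoorReadoutPeriodised (translate_smul_eq_smul_translate)
open Summit.QuantumFields.BalabanUV.Beta.FP.TowerDoorDefectDefs
open Summit.QuantumFields.BalabanUV.Beta.FP.TowerDoorDefectLoc (biLoc_defKerZ)
open Summit.QuantumFields.BalabanUV.Beta.FP.TowerDoorDefectFamilyLoc (l1_natCast_zsmul biLoc_defKerZ_of_loc)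
open Summit.QuantumFields.BalabanUV.Beta.FP.TowerDoorDefectLinear (defKerZ_tsum abs_le_of_tsum_abs_le)

namespace Summit.QuantumFields.BalabanUV.Beta.FP.TowerDoorPeriodisedSource

variable (L : ℕ) (tabs : SymTables 3 L) (κ₂ : ℝ)

/-! ## §1 Rates read off the table record; the defect kernels' bi-localisation at every source -/

/-- [folklore] **`exists_aligned_rates`** — ONE rate `ρ ≤ δv` at which (Lmix) and (LH) hold, read off `tabs.hmix` (weakened by lit `LocStencilFM.mono`) and `tabs.hH` (every rate). -/
theorem exists_aligned_rates {δv : ℝ} (hδv : 0 < δv) :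
    ∃ ρ C C_H : ℝ, 0 < ρ ∧ ρ ≤ δv ∧ LocStencilFM L tabs.mixFF C ρ ∧ VertexFamily tabs.H L C_H ρ := by
  obtain ⟨C, δ, hδ, hmix⟩ := tabs.hmix
  obtain ⟨C_H, hH⟩ := tabs.hH (min δ δv) (le_min hδ.le hδv.le)
  exact ⟨min δ δv, C, C_H, lt_min hδ hδv, min_le_right _ _, hmix.mono (min_le_left _ _), hH⟩

/-- [folklore] **`exists_biLoc_defKerZ_lam`** — for a gauge-function family localised as `|lam μ y u| ≤ K·e^{−δv|L•y − u|₁}` (PART 59's shape), ONE rate `ρ > 0` and ONE constant `A ≥ 0` with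
`BiLoc (defKerZ L tabs κ₂ (lam μ q) β) (L•β.1) (L•β.1) (A·e^{−(ρ/2)|L•q − L•β.1|₁}) (ρ/4)` at every source `(μ, q)` and window `β` (road (R1) `biLoc_defKerZ_of_loc` at §1's aligned rate). -/
theorem exists_biLoc_defKerZ_lam {lam : Fin (3 + 1) → Site (3 + 1) → (Site (3 + 1) → ℝ)} {K δv : ℝ} (hK : 0 ≤ K) (hδv : 0 < δv)
    (hlam : ∀ μ y u, |lam μ y u| ≤ K * Real.exp (-δv * l1 (((L : ℕ) : ℤ) • y - u))) :
    ∃ ρ A : ℝ, 0 < ρ ∧ 0 ≤ A ∧ ∀ (μ : Fin (3 + 1)) (q : Site (3 + 1)) (β : Site (3 + 1) × Fin (3 + 1)),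
      BiLoc (defKerZ L tabs κ₂ (lam μ q) β) (((L : ℕ) : ℤ) • β.1) (((L : ℕ) : ℤ) • β.1)
        (A * Real.exp (-(ρ / 2) * l1 (((L : ℕ) : ℤ) • q - ((L : ℕ) : ℤ) • β.1))) (ρ / 4) := by
  obtain ⟨ρ, C, C_H, hρ, hρv, hmix, hH⟩ := exists_aligned_rates L tabs hδv
  have hC : 0 ≤ C := hmix.nonneg
  have hCH : 0 ≤ C_H := (hH 0 0).nonneg (Sum.inl 0)
  have hZ : 0 ≤ Zl (3 + 1) (ρ / 4) := Zl_nonneg (by positivity)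
  refine ⟨ρ, ((3 + 1 : ℕ) : ℝ) * (K * (1 + Real.exp ρ) * (|wM2 3 L 0| * C) * Zl (3 + 1) (ρ / 4)) + 2 * |κ₂| * K * C_H, hρ, by positivity,
    fun μ q β => ?_⟩
  exact biLoc_defKerZ_of_loc L tabs hmix hH κ₂ hK (hlam μ q) hρ hρv le_rfl le_rfl β

/-- [folklore] **`exists_biLoc_defKerZ_bdd`** — for BOUNDED gauge functions `|v u| ≤ V`, ONE rate and ONE constant with `BiLoc (defKerZ L tabs κ₂ v β) (L•β.1) (L•β.1) A ρ` (PART 64 `biLoc_defKerZ`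
at `tabs.hmix`'s rate with (LH) read off at half that rate). -/
theorem exists_biLoc_defKerZ_bdd {V : ℝ} (hV : 0 ≤ V) :
    ∃ ρ A : ℝ, 0 < ρ ∧ 0 ≤ A ∧ ∀ (v : Site (3 + 1) → ℝ), (∀ u, |v u| ≤ V) → ∀ β : Site (3 + 1) × Fin (3 + 1),
      BiLoc (defKerZ L tabs κ₂ v β) (((L : ℕ) : ℤ) • β.1) (((L : ℕ) : ℤ) • β.1) A ρ := by
  obtain ⟨C, δ, hδ, hmix⟩ := tabs.hmix
  obtain ⟨C_H, hH⟩ := tabs.hH (δ / 2) (half_pos hδ).le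
  have hC : 0 ≤ C := hmix.nonneg
  have hCH : 0 ≤ C_H := (hH 0 0).nonneg (Sum.inl 0)
  have hZ : 0 ≤ Zl (3 + 1) (δ / 2) := Zl_nonneg (half_pos hδ)
  refine ⟨δ / 2, ((3 + 1 : ℕ) : ℝ) * (2 * V * (|wM2 3 L 0| * C) * Zl (3 + 1) (δ / 2)) + 2 * |κ₂| * V * C_H, half_pos hδ, by positivity,
    fun v hv β => ?_⟩
  exact biLoc_defKerZ L tabs hmix hδ hH κ₂ hV hv β

/-- [folklore] **`exp_block_le`** — a block distance dominates the coarse distance: `e^{−ρ|L•y − L•y₀|₁} ≤ e^{−ρ|y − y₀|₁}` for `ρ ≥ 0`, `L ≥ 1`. -/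
theorem exp_block_le (hL : 1 ≤ L) {ρ : ℝ} (hρ : 0 ≤ ρ) (y y₀ : Site (3 + 1)) :
    Real.exp (-ρ * l1 (((L : ℕ) : ℤ) • y - ((L : ℕ) : ℤ) • y₀)) ≤ Real.exp (-ρ * l1 (y - y₀)) := by
  rw [← smul_sub, l1_natCast_zsmul, Real.exp_le_exp]
  have hL' : (1 : ℝ) ≤ (L : ℝ) := by exact_mod_cast hL
  have h1 : l1 (y - y₀) ≤ (L : ℝ) * l1 (y - y₀) := le_mul_of_one_le_left (l1_nonneg _) hL'
  nlinarith [mul_le_mul_of_nonneg_left h1 hρ]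

/-! ## §2 The source copies of a localised gauge function: summable, bounded sum -/

section Sources

variable {L}
variable {lam : Fin (3 + 1) → Site (3 + 1) → (Site (3 + 1) → ℝ)} {K δv : ℝ}

/-- [folklore] the copy `e` of the gauge function of the source `(μ, y)` is localised at `translate T (L•y) e` (`L • translate Mc y e = translate T (L•y) e`, PART 47). -/
theorem abs_lam_translate_le (Mc T : Fin (3 + 1) → ℕ) (hT : ∀ i, T i = L * Mc i) (hlam : ∀ μ y u, |lam μ y u| ≤ K * Real.exp (-δv * l1 (((L : ℕ) : ℤ) • y - u)))
    (μ : Fin (3 + 1)) (y u e : Site (3 + 1)) :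
    |lam μ (translate Mc y e) u| ≤ K * Real.exp (-δv * l1 (translate T (((L : ℕ) : ℤ) • y) e - u)) := by
  rw [translate_smul_eq_smul_translate L T Mc hT y e]
  exact hlam μ (translate Mc y e) u

/-- [folklore] **`summable_abs_lam_sources`** — the source copies are absolutely summable at every site, with `Σ'_e |lam μ (translate Mc y e) u| ≤ K·K₄(δv)` uniformly
(road `summable_exp_l1_translate` over the torus `T`). -/
theorem summable_abs_lam_sources (Mc T : Fin (3 + 1) → ℕ) [∀ i, NeZero (T i)] (hT : ∀ i, T i = L * Mc i) (hK : 0 ≤ K) (hδv : 0 < δv) (hlam : ∀ μ y u, |lam μ y u| ≤ K * Real.exp (-δv * l1 (((L : ℕ) : ℤ) • y - u)))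
    (μ : Fin (3 + 1)) (y u : Site (3 + 1)) :
    Summable (fun e : Site (3 + 1) => |lam μ (translate Mc y e) u|) ∧
      ∑' e : Site (3 + 1), |lam μ (translate Mc y e) u| ≤ K * latticeConst (3 + 1) δv := by
  obtain ⟨hs, hle⟩ := summable_exp_l1_translate T hδv u (((L : ℕ) : ℤ) • y)
  have hb : ∀ e : Site (3 + 1), |lam μ (translate Mc y e) u| ≤ K * Real.exp (-δv * l1 (translate T (((L : ℕ) : ℤ) • y) e - u)) :=
    fun e => abs_lam_translate_le Mc T hT hlam μ y u e
  have hs' : Summable (fun e : Site (3 + 1) => |lam μ (translate Mc y e) u|) :=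
    (hs.mul_left K).of_nonneg_of_le (fun e => abs_nonneg _) hb
  refine ⟨hs', (hs'.tsum_le_tsum hb (hs.mul_left K)).trans ?_⟩
  rw [tsum_mul_left]
  exact mul_le_mul_of_nonneg_left hle hK

/-- [folklore] **`abs_tsum_lam_sources_le`** — THE PERIODISED GAUGE FUNCTION IS BOUNDED: `|Σ'_e lam μ (translate Mc y e) u| ≤ K·K₄(δv)` (Mathlib `norm_tsum_le_tsum_norm`). -/
theorem abs_tsum_lam_sources_le (Mc T : Fin (3 + 1) → ℕ) [∀ i, NeZero (T i)] (hT : ∀ i, T i = L * Mc i) (hK : 0 ≤ K) (hδv : 0 < δv) (hlam : ∀ μ y u, |lam μ y u| ≤ K * Real.exp (-δv * l1 (((L : ℕ) : ℤ) • y - u)))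
    (μ : Fin (3 + 1)) (y u : Site (3 + 1)) :
    |∑' e : Site (3 + 1), lam μ (translate Mc y e) u| ≤ K * latticeConst (3 + 1) δv := by
  obtain ⟨hs, hle⟩ := summable_abs_lam_sources Mc T hT hK hδv hlam μ y u
  have h := norm_tsum_le_tsum_norm (f := fun e : Site (3 + 1) => lam μ (translate Mc y e) u) (by simpa only [Real.norm_eq_abs] using hs)
  simp only [Real.norm_eq_abs] at h
  exact h.trans hle

end Sources

/-! ## §3 The two source-wound window terms -/

section Terms

variable {L}
variable (lam : Fin (3 + 1) → Site (3 + 1) → (Site (3 + 1) → ℝ)) (S : Fin (3 + 1) → Site (3 + 1) → Fin (3 + 1) → Site (3 + 1) → ℝ)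
variable {K δv CS δS : ℝ}

/-- [folklore] **`tsum_sources_weight_mul_defKerZ` — THE `μ`-SOURCE TERM: THE WINDING LANDS ON THE WEIGHT.**  At fixed legs and direction `κ`,
`Σ'_e Σ'_{y₀} S ν (translate Mc y′ e) κ y₀ · D(y₀) = Σ'_{y₀} (Σ'_e S ν (translate Mc y′ e) κ y₀) · D(y₀)`, `D(y₀) := defKerZ … (lam μ y) (y₀,κ) x w a b`, with the summabilities it produces
(dominated by `CS·e^{−δS|y₀ − y′ − Mc∘e|₁} · A·e^{−(ρ/2)|y − y₀|₁}`: the `e`-sum a translate sum, the `y₀`-sum a shifted exponential sum). -/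
theorem tsum_sources_weight_mul_defKerZ [NeZero L] (Mc : Fin (3 + 1) → ℕ) [∀ i, NeZero (Mc i)] (hK : 0 ≤ K) (hδv : 0 < δv) (hlam : ∀ μ y u, |lam μ y u| ≤ K * Real.exp (-δv * l1 (((L : ℕ) : ℤ) • y - u)))
    (hCS : 0 ≤ CS) (hδS : 0 < δS) (hS : ∀ ν z κ y₀, |S ν z κ y₀| ≤ CS * Real.exp (-δS * l1 (y₀ - z)))
    (μ : Fin (3 + 1)) (y : Site (3 + 1)) (ν : Fin (3 + 1)) (y' : Site (3 + 1)) (κ : Fin (3 + 1)) (x w : Site (3 + 1)) (a b : Fib 3) :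
    (∑' e : Site (3 + 1), ∑' y₀ : Site (3 + 1), S ν (translate Mc y' e) κ y₀ * defKerZ L tabs κ₂ (lam μ y) (y₀, κ) x w a b
        = ∑' y₀ : Site (3 + 1), (∑' e : Site (3 + 1), S ν (translate Mc y' e) κ y₀) * defKerZ L tabs κ₂ (lam μ y) (y₀, κ) x w a b) ∧
      Summable (fun e : Site (3 + 1) => ∑' y₀ : Site (3 + 1), S ν (translate Mc y' e) κ y₀ * defKerZ L tabs κ₂ (lam μ y) (y₀, κ) x w a b) ∧
      Summable (fun y₀ : Site (3 + 1) => (∑' e : Site (3 + 1), S ν (translate Mc y' e) κ y₀) * defKerZ L tabs κ₂ (lam μ y) (y₀, κ) x w a b) ∧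
      (∀ e : Site (3 + 1), Summable (fun y₀ : Site (3 + 1) => S ν (translate Mc y' e) κ y₀ * defKerZ L tabs κ₂ (lam μ y) (y₀, κ) x w a b)) := by
  have hL : 1 ≤ L := Nat.one_le_iff_ne_zero.mpr (NeZero.ne L)
  obtain ⟨ρ, A, hρ, hA, hD⟩ := exists_biLoc_defKerZ_lam L tabs κ₂ hK hδv hlam
  -- the defect kernel at the window `y₀`, bounded by `A·e^{−(ρ/2)|y − y₀|₁}`
  have hDb : ∀ y₀ : Site (3 + 1), |defKerZ L tabs κ₂ (lam μ y) (y₀, κ) x w a b| ≤ A * Real.exp (-(ρ / 2) * l1 (y - y₀)) := by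
    intro y₀
    refine ((hD μ y (y₀, κ)) x w a b).trans ?_
    calc A * Real.exp (-(ρ / 2) * l1 (((L : ℕ) : ℤ) • y - ((L : ℕ) : ℤ) • y₀))
          * Real.exp (-(ρ / 4) * (l1 (x - ((L : ℕ) : ℤ) • y₀) + l1 (w - ((L : ℕ) : ℤ) • y₀)))
        ≤ A * Real.exp (-(ρ / 2) * l1 (((L : ℕ) : ℤ) • y - ((L : ℕ) : ℤ) • y₀)) := by
          refine mul_le_of_le_one_right (by positivity) (Real.exp_le_one_iff.mpr ?_)
          nlinarith [l1_nonneg (x - ((L : ℕ) : ℤ) • y₀), l1_nonneg (w - ((L : ℕ) : ℤ) • y₀)]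
      _ ≤ A * Real.exp (-(ρ / 2) * l1 (y - y₀)) := mul_le_mul_of_nonneg_left (exp_block_le L hL (by positivity) y y₀) hA
  -- the weight copies at the window `y₀`: a translate sum
  have hSe : ∀ y₀ : Site (3 + 1), Summable (fun e : Site (3 + 1) => CS * Real.exp (-δS * l1 (y₀ - translate Mc y' e))) ∧
      ∑' e : Site (3 + 1), CS * Real.exp (-δS * l1 (y₀ - translate Mc y' e)) ≤ CS * latticeConst (3 + 1) δS := by
    intro y₀
    obtain ⟨hs, hle⟩ := summable_exp_l1_translate Mc hδS y₀ y'
    have he : (fun e : Site (3 + 1) => Real.exp (-δS * l1 (y₀ - translate Mc y' e))) = fun e => Real.exp (-δS * l1 (translate Mc y' e - y₀)) := by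
      funext e; rw [l1_sub_symm]
    refine ⟨?_, ?_⟩
    · rw [show (fun e : Site (3 + 1) => CS * Real.exp (-δS * l1 (y₀ - translate Mc y' e)))
          = fun e => CS * (fun e => Real.exp (-δS * l1 (y₀ - translate Mc y' e))) e from rfl, he]
      exact hs.mul_left CS
    · rw [tsum_mul_left, he]; exact mul_le_mul_of_nonneg_left hle hCS
  -- the dominated family, in the order `(y₀, e)`
  have hG0 : ∀ p : Site (3 + 1) × Site (3 + 1),
      0 ≤ CS * Real.exp (-δS * l1 (p.1 - translate Mc y' p.2)) * (A * Real.exp (-(ρ / 2) * l1 (y - p.1))) := fun p => by positivity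
  have hGs : Summable (fun p : Site (3 + 1) × Site (3 + 1) =>
      CS * Real.exp (-δS * l1 (p.1 - translate Mc y' p.2)) * (A * Real.exp (-(ρ / 2) * l1 (y - p.1)))) := by
    have hrow : ∀ y₀ : Site (3 + 1),
        ∑' e : Site (3 + 1), CS * Real.exp (-δS * l1 (y₀ - translate Mc y' e)) * (A * Real.exp (-(ρ / 2) * l1 (y - y₀)))
          ≤ CS * latticeConst (3 + 1) δS * A * Real.exp (-(ρ / 2) * l1 (y - y₀)) := by
      intro y₀
      rw [tsum_mul_right]
      calc (∑' e : Site (3 + 1), CS * Real.exp (-δS * l1 (y₀ - translate Mc y' e))) * (A * Real.exp (-(ρ / 2) * l1 (y - y₀)))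
          ≤ (CS * latticeConst (3 + 1) δS) * (A * Real.exp (-(ρ / 2) * l1 (y - y₀))) := mul_le_mul_of_nonneg_right (hSe y₀).2 (by positivity)
        _ = CS * latticeConst (3 + 1) δS * A * Real.exp (-(ρ / 2) * l1 (y - y₀)) := by ring
    refine (summable_prod_of_nonneg hG0).2 ⟨fun y₀ => (hSe y₀).1.mul_right (A * Real.exp (-(ρ / 2) * l1 (y - y₀))), ?_⟩
    exact ((summable_exp_shift (half_pos hρ) y).mul_left (CS * latticeConst (3 + 1) δS * A)).of_nonneg_of_le
      (fun y₀ => tsum_nonneg fun e => hG0 (y₀, e)) hrow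
  have hF : Summable (fun p : Site (3 + 1) × Site (3 + 1) => S ν (translate Mc y' p.2) κ p.1 * defKerZ L tabs κ₂ (lam μ y) (p.1, κ) x w a b) := by
    refine hGs.of_norm_bounded fun p => ?_
    rw [Real.norm_eq_abs, abs_mul]
    exact mul_le_mul (hS ν _ κ p.1) (hDb p.1) (abs_nonneg _) (by positivity)
  -- the exchange
  have hF' : Summable (Function.uncurry fun (y₀ e : Site (3 + 1)) => S ν (translate Mc y' e) κ y₀ * defKerZ L tabs κ₂ (lam μ y) (y₀, κ) x w a b) := hF
  have hcomm : ∑' e : Site (3 + 1), ∑' y₀ : Site (3 + 1), S ν (translate Mc y' e) κ y₀ * defKerZ L tabs κ₂ (lam μ y) (y₀, κ) x w a b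
      = ∑' y₀ : Site (3 + 1), ∑' e : Site (3 + 1), S ν (translate Mc y' e) κ y₀ * defKerZ L tabs κ₂ (lam μ y) (y₀, κ) x w a b := hF'.tsum_comm
  have hFs : Summable (fun q : Site (3 + 1) × Site (3 + 1) => S ν (translate Mc y' q.1) κ q.2 * defKerZ L tabs κ₂ (lam μ y) (q.2, κ) x w a b) :=
    hF.prod_symm
  have hprod : Summable (fun y₀ : Site (3 + 1) => (∑' e : Site (3 + 1), S ν (translate Mc y' e) κ y₀) * defKerZ L tabs κ₂ (lam μ y) (y₀, κ) x w a b) := by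
    refine hF.prod.congr fun y₀ => ?_
    show (∑' e : Site (3 + 1), S ν (translate Mc y' e) κ y₀ * defKerZ L tabs κ₂ (lam μ y) (y₀, κ) x w a b) = _
    exact tsum_mul_right
  refine ⟨?_, hFs.prod, hprod, fun e => hFs.prod_factor e⟩
  rw [hcomm]
  exact tsum_congr fun y₀ => tsum_mul_right

/-- [folklore] **`tsum_sources_weight_mul_defKerZ_gauge` — THE `ν`-SOURCE TERM: THE WINDING LANDS INSIDE THE GAUGE SLOT.**  At fixed legs and direction `κ`,
`Σ'_e Σ'_{y₀} S μ y κ y₀ · defKerZ … (lam ν (translate Mc y′ e)) (y₀,κ) x w a b = Σ'_{y₀} S μ y κ y₀ · defKerZ … (u ↦ Σ'_e lam ν (translate Mc y′ e) u) (y₀,κ) x w a b` (road (R3) `defKerZ_tsum`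
at §2's `ℓ¹` letters), with the summabilities it produces (dominated by `CS·e^{−δS|y₀ − y|₁} · A·e^{−(ρ/2)|translate T (L•y′) e − L•y₀|₁}`). -/
theorem tsum_sources_weight_mul_defKerZ_gauge (Mc T : Fin (3 + 1) → ℕ) [∀ i, NeZero (T i)] (hT : ∀ i, T i = L * Mc i) (hK : 0 ≤ K) (hδv : 0 < δv) (hlam : ∀ μ y u, |lam μ y u| ≤ K * Real.exp (-δv * l1 (((L : ℕ) : ℤ) • y - u)))
    (hCS : 0 ≤ CS) (hδS : 0 < δS) (hS : ∀ ν z κ y₀, |S ν z κ y₀| ≤ CS * Real.exp (-δS * l1 (y₀ - z)))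
    (μ : Fin (3 + 1)) (y : Site (3 + 1)) (ν : Fin (3 + 1)) (y' : Site (3 + 1)) (κ : Fin (3 + 1)) (x w : Site (3 + 1)) (a b : Fib 3) :
    (∑' e : Site (3 + 1), ∑' y₀ : Site (3 + 1), S μ y κ y₀ * defKerZ L tabs κ₂ (lam ν (translate Mc y' e)) (y₀, κ) x w a b
        = ∑' y₀ : Site (3 + 1), S μ y κ y₀ * defKerZ L tabs κ₂ (fun u => ∑' e : Site (3 + 1), lam ν (translate Mc y' e) u) (y₀, κ) x w a b) ∧
      Summable (fun e : Site (3 + 1) => ∑' y₀ : Site (3 + 1), S μ y κ y₀ * defKerZ L tabs κ₂ (lam ν (translate Mc y' e)) (y₀, κ) x w a b) ∧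
      Summable (fun y₀ : Site (3 + 1) => S μ y κ y₀ * defKerZ L tabs κ₂ (fun u => ∑' e : Site (3 + 1), lam ν (translate Mc y' e) u) (y₀, κ) x w a b) ∧
      (∀ e : Site (3 + 1), Summable (fun y₀ : Site (3 + 1) => S μ y κ y₀ * defKerZ L tabs κ₂ (lam ν (translate Mc y' e)) (y₀, κ) x w a b)) := by
  obtain ⟨ρ, A, hρ, hA, hD⟩ := exists_biLoc_defKerZ_lam L tabs κ₂ hK hδv hlam
  obtain ⟨C, δ, hδ, hmix⟩ := tabs.hmix
  -- the defect kernel of the copy `e` at the window `y₀`, bounded by `A·e^{−(ρ/2)|translate T (L•y′) e − L•y₀|₁}`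
  have hDb : ∀ (e y₀ : Site (3 + 1)), |defKerZ L tabs κ₂ (lam ν (translate Mc y' e)) (y₀, κ) x w a b|
      ≤ A * Real.exp (-(ρ / 2) * l1 (translate T (((L : ℕ) : ℤ) • y') e - ((L : ℕ) : ℤ) • y₀)) := by
    intro e y₀
    refine ((hD ν (translate Mc y' e) (y₀, κ)) x w a b).trans ?_
    rw [← translate_smul_eq_smul_translate L T Mc hT y' e]
    refine mul_le_of_le_one_right (by positivity) (Real.exp_le_one_iff.mpr ?_)
    nlinarith [l1_nonneg (x - ((L : ℕ) : ℤ) • y₀), l1_nonneg (w - ((L : ℕ) : ℤ) • y₀)]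
  have hDe : ∀ y₀ : Site (3 + 1), Summable (fun e : Site (3 + 1) => A * Real.exp (-(ρ / 2) * l1 (translate T (((L : ℕ) : ℤ) • y') e - ((L : ℕ) : ℤ) • y₀))) ∧
      ∑' e : Site (3 + 1), A * Real.exp (-(ρ / 2) * l1 (translate T (((L : ℕ) : ℤ) • y') e - ((L : ℕ) : ℤ) • y₀)) ≤ A * latticeConst (3 + 1) (ρ / 2) := by
    intro y₀
    obtain ⟨hs, hle⟩ := summable_exp_l1_translate T (half_pos hρ) (((L : ℕ) : ℤ) • y₀) (((L : ℕ) : ℤ) • y')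
    refine ⟨hs.mul_left A, ?_⟩
    rw [tsum_mul_left]; exact mul_le_mul_of_nonneg_left hle hA
  -- the dominated family, in the order `(y₀, e)`
  have hG0 : ∀ p : Site (3 + 1) × Site (3 + 1),
      0 ≤ CS * Real.exp (-δS * l1 (p.1 - y)) * (A * Real.exp (-(ρ / 2) * l1 (translate T (((L : ℕ) : ℤ) • y') p.2 - ((L : ℕ) : ℤ) • p.1))) :=
    fun p => by positivity
  have hGs : Summable (fun p : Site (3 + 1) × Site (3 + 1) =>
      CS * Real.exp (-δS * l1 (p.1 - y)) * (A * Real.exp (-(ρ / 2) * l1 (translate T (((L : ℕ) : ℤ) • y') p.2 - ((L : ℕ) : ℤ) • p.1)))) := by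
    have hrow : ∀ y₀ : Site (3 + 1),
        ∑' e : Site (3 + 1), CS * Real.exp (-δS * l1 (y₀ - y)) * (A * Real.exp (-(ρ / 2) * l1 (translate T (((L : ℕ) : ℤ) • y') e - ((L : ℕ) : ℤ) • y₀)))
          ≤ CS * (A * latticeConst (3 + 1) (ρ / 2)) * Real.exp (-δS * l1 (y₀ - y)) := by
      intro y₀
      rw [tsum_mul_left]
      calc CS * Real.exp (-δS * l1 (y₀ - y)) * ∑' e : Site (3 + 1), A * Real.exp (-(ρ / 2) * l1 (translate T (((L : ℕ) : ℤ) • y') e - ((L : ℕ) : ℤ) • y₀))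
          ≤ CS * Real.exp (-δS * l1 (y₀ - y)) * (A * latticeConst (3 + 1) (ρ / 2)) := mul_le_mul_of_nonneg_left (hDe y₀).2 (by positivity)
        _ = CS * (A * latticeConst (3 + 1) (ρ / 2)) * Real.exp (-δS * l1 (y₀ - y)) := by ring
    refine (summable_prod_of_nonneg hG0).2 ⟨fun y₀ => (hDe y₀).1.mul_left (CS * Real.exp (-δS * l1 (y₀ - y))), ?_⟩
    exact ((summable_exp_shift' hδS y).mul_left (CS * (A * latticeConst (3 + 1) (ρ / 2)))).of_nonneg_of_le
      (fun y₀ => tsum_nonneg fun e => hG0 (y₀, e)) hrow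
  have hF : Summable (fun p : Site (3 + 1) × Site (3 + 1) =>
      S μ y κ p.1 * defKerZ L tabs κ₂ (lam ν (translate Mc y' p.2)) (p.1, κ) x w a b) := by
    refine hGs.of_norm_bounded fun p => ?_
    rw [Real.norm_eq_abs, abs_mul]
    exact mul_le_mul (hS μ y κ p.1) (hDb p.2 p.1) (abs_nonneg _) (by positivity)
  -- the exchange and road (R3) inside the gauge slot
  have hF' : Summable (Function.uncurry fun (y₀ e : Site (3 + 1)) => S μ y κ y₀ * defKerZ L tabs κ₂ (lam ν (translate Mc y' e)) (y₀, κ) x w a b) := hF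
  have hcomm : ∑' e : Site (3 + 1), ∑' y₀ : Site (3 + 1), S μ y κ y₀ * defKerZ L tabs κ₂ (lam ν (translate Mc y' e)) (y₀, κ) x w a b
      = ∑' y₀ : Site (3 + 1), ∑' e : Site (3 + 1), S μ y κ y₀ * defKerZ L tabs κ₂ (lam ν (translate Mc y' e)) (y₀, κ) x w a b := hF'.tsum_comm
  have habs : ∀ u : Site (3 + 1), Summable (fun e : Site (3 + 1) => |lam ν (translate Mc y' e) u|) :=
    fun u => (summable_abs_lam_sources Mc T hT hK hδv hlam ν y' u).1
  have hV : ∀ u : Site (3 + 1), ∑' e : Site (3 + 1), |lam ν (translate Mc y' e) u| ≤ K * latticeConst (3 + 1) δv :=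
    fun u => (summable_abs_lam_sources Mc T hT hK hδv hlam ν y' u).2
  have hin : ∀ y₀ : Site (3 + 1), ∑' e : Site (3 + 1), S μ y κ y₀ * defKerZ L tabs κ₂ (lam ν (translate Mc y' e)) (y₀, κ) x w a b
      = S μ y κ y₀ * defKerZ L tabs κ₂ (fun u => ∑' e : Site (3 + 1), lam ν (translate Mc y' e) u) (y₀, κ) x w a b := by
    intro y₀
    rw [tsum_mul_left, defKerZ_tsum L tabs hmix hδ κ₂ habs hV (y₀, κ) x w a b]
  have hFs : Summable (fun q : Site (3 + 1) × Site (3 + 1) => S μ y κ q.2 * defKerZ L tabs κ₂ (lam ν (translate Mc y' q.1)) (q.2, κ) x w a b) :=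
    hF.prod_symm
  refine ⟨?_, hFs.prod, hF.prod.congr hin, fun e => hFs.prod_factor e⟩
  rw [hcomm]
  exact tsum_congr hin

end Terms

/-! ## §4 The source winding of the door, pointwise and as a kernel equation -/

section Door

variable {L}
variable (κΔ : ℝ) (lam : Fin (3 + 1) → Site (3 + 1) → (Site (3 + 1) → ℝ)) (S : Fin (3 + 1) → Site (3 + 1) → Fin (3 + 1) → Site (3 + 1) → ℝ)
variable (Mc : Fin (3 + 1) → ℕ) [∀ i, NeZero (Mc i)] (T : Fin (3 + 1) → ℕ) [∀ i, NeZero (T i)] (hT : ∀ i, T i = L * Mc i)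
variable {K δv CS δS : ℝ}

include hT in
/-- [folklore] **`tsum_sources_doorZ_apply` — THE SOURCE WINDING OF THE DOOR, POINTWISE** (PART 62 `doorZ_apply`; the scalar and the direction sum pulled out of the `e`-series by `tsum_mul_left` and
Mathlib `Summable.tsum_finsetSum`; §3 per direction):
`Σ'_e doorZ … μ y ν (translate Mc y′ e) x w a b = κΔ · Σ_κ Σ'_{y₀} ((Σ'_e S ν (translate Mc y′ e) κ y₀) · defKerZ … (lam μ y) (y₀,κ) x w a b + S μ y κ y₀ · defKerZ … (u ↦ Σ'_e lam ν (translate Mc y′ e) u) (y₀,κ) x w a b)`. -/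
theorem tsum_sources_doorZ_apply [NeZero L] (hK : 0 ≤ K) (hδv : 0 < δv) (hlam : ∀ μ y u, |lam μ y u| ≤ K * Real.exp (-δv * l1 (((L : ℕ) : ℤ) • y - u)))
    (hCS : 0 ≤ CS) (hδS : 0 < δS) (hS : ∀ ν z κ y₀, |S ν z κ y₀| ≤ CS * Real.exp (-δS * l1 (y₀ - z)))
    (μ : Fin (3 + 1)) (y : Site (3 + 1)) (ν : Fin (3 + 1)) (y' : Site (3 + 1)) (x w : Site (3 + 1)) (a b : Fib 3) :
    ∑' e : Site (3 + 1), doorZ L tabs κ₂ κΔ lam S μ y ν (translate Mc y' e) x w a b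
      = κΔ * ∑ κ : Fin (3 + 1), ∑' y₀ : Site (3 + 1),
          ((∑' e : Site (3 + 1), S ν (translate Mc y' e) κ y₀) * defKerZ L tabs κ₂ (lam μ y) (y₀, κ) x w a b
            + S μ y κ y₀ * defKerZ L tabs κ₂ (fun u => ∑' e : Site (3 + 1), lam ν (translate Mc y' e) u) (y₀, κ) x w a b) := by
  simp only [doorZ_apply]
  rw [tsum_mul_left]
  congr 1
  -- per direction: the two §3 terms
  have hκ : ∀ κ : Fin (3 + 1),
      (∑' e : Site (3 + 1), ∑' y₀ : Site (3 + 1),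
          (S ν (translate Mc y' e) κ y₀ * defKerZ L tabs κ₂ (lam μ y) (y₀, κ) x w a b
            + S μ y κ y₀ * defKerZ L tabs κ₂ (lam ν (translate Mc y' e)) (y₀, κ) x w a b)
        = ∑' y₀ : Site (3 + 1),
          ((∑' e : Site (3 + 1), S ν (translate Mc y' e) κ y₀) * defKerZ L tabs κ₂ (lam μ y) (y₀, κ) x w a b
            + S μ y κ y₀ * defKerZ L tabs κ₂ (fun u => ∑' e : Site (3 + 1), lam ν (translate Mc y' e) u) (y₀, κ) x w a b)) ∧
      Summable (fun e : Site (3 + 1) => ∑' y₀ : Site (3 + 1),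
          (S ν (translate Mc y' e) κ y₀ * defKerZ L tabs κ₂ (lam μ y) (y₀, κ) x w a b
            + S μ y κ y₀ * defKerZ L tabs κ₂ (lam ν (translate Mc y' e)) (y₀, κ) x w a b)) := by
    intro κ
    obtain ⟨hA, hAe, hAy, hAye⟩ := tsum_sources_weight_mul_defKerZ tabs κ₂ lam S Mc hK hδv hlam hCS hδS hS μ y ν y' κ x w a b
    obtain ⟨hB, hBe, hBy, hBye⟩ := tsum_sources_weight_mul_defKerZ_gauge tabs κ₂ lam S Mc T hT hK hδv hlam hCS hδS hS μ y ν y' κ x w a b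
    refine ⟨?_, (hAe.add hBe).congr fun e => ((hAye e).tsum_add (hBye e)).symm⟩
    calc (∑' e : Site (3 + 1), ∑' y₀ : Site (3 + 1),
          (S ν (translate Mc y' e) κ y₀ * defKerZ L tabs κ₂ (lam μ y) (y₀, κ) x w a b
            + S μ y κ y₀ * defKerZ L tabs κ₂ (lam ν (translate Mc y' e)) (y₀, κ) x w a b))
        = ∑' e : Site (3 + 1), ((∑' y₀ : Site (3 + 1), S ν (translate Mc y' e) κ y₀ * defKerZ L tabs κ₂ (lam μ y) (y₀, κ) x w a b)
            + ∑' y₀ : Site (3 + 1), S μ y κ y₀ * defKerZ L tabs κ₂ (lam ν (translate Mc y' e)) (y₀, κ) x w a b) :=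
          tsum_congr fun e => (hAye e).tsum_add (hBye e)
      _ = (∑' e : Site (3 + 1), ∑' y₀ : Site (3 + 1), S ν (translate Mc y' e) κ y₀ * defKerZ L tabs κ₂ (lam μ y) (y₀, κ) x w a b)
            + ∑' e : Site (3 + 1), ∑' y₀ : Site (3 + 1), S μ y κ y₀ * defKerZ L tabs κ₂ (lam ν (translate Mc y' e)) (y₀, κ) x w a b :=
          hAe.tsum_add hBe
      _ = _ := by rw [hA, hB, ← hAy.tsum_add hBy]
  rw [Summable.tsum_finsetSum (fun κ _ => (hκ κ).2)]
  exact Finset.sum_congr rfl fun κ _ => (hκ κ).1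

include hT in
/-- [folklore] **`tsum_sources_doorZ_eq`** — the same as a KERNEL equation (so that `perF T (dper T ·)` of (T2)'s left side is `perF T (dper T ·)` of the window superposition by `congrArg`). -/
theorem tsum_sources_doorZ_eq [NeZero L] (hK : 0 ≤ K) (hδv : 0 < δv) (hlam : ∀ μ y u, |lam μ y u| ≤ K * Real.exp (-δv * l1 (((L : ℕ) : ℤ) • y - u)))
    (hCS : 0 ≤ CS) (hδS : 0 < δS) (hS : ∀ ν z κ y₀, |S ν z κ y₀| ≤ CS * Real.exp (-δS * l1 (y₀ - z)))
    (μ : Fin (3 + 1)) (y : Site (3 + 1)) (ν : Fin (3 + 1)) (y' : Site (3 + 1)) :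
    (fun x w a b => ∑' e : Site (3 + 1), doorZ L tabs κ₂ κΔ lam S μ y ν (translate Mc y' e) x w a b)
      = fun x w a b => κΔ * ∑ κ : Fin (3 + 1), ∑' y₀ : Site (3 + 1),
          ((∑' e : Site (3 + 1), S ν (translate Mc y' e) κ y₀) * defKerZ L tabs κ₂ (lam μ y) (y₀, κ) x w a b
            + S μ y κ y₀ * defKerZ L tabs κ₂ (fun u => ∑' e : Site (3 + 1), lam ν (translate Mc y' e) u) (y₀, κ) x w a b) := by
  funext x w a b
  exact tsum_sources_doorZ_apply tabs κ₂ κΔ lam S Mc T hT hK hδv hlam hCS hδS hS μ y ν y' x w a b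

end Door

end Summit.QuantumFields.BalabanUV.Beta.FP.TowerDoorPeriodisedSource

end
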